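import Mathlib.NumberTheory.Chebyshev
import Mathlib.NumberTheory.AbelSummation
import Mathlib.MeasureTheory.Integral.IntervalIntegral.IntegrationByParts
import Literature.NumberTheory.LFunctions.ChebyshevHalfLineBiasVariants
import Literature.NumberTheory.LFunctions.RHWave0PNTProofs
import HarnessLib

/-!
# RH-FREE average over moduli (Suzuki 2025, Thm 7), PROVED — «nothing here bears on the truth of RH»
# `Σ_{3 ≤ q ≤ Q} Σ_{χ mod q} Σ_{n ≤ y} Λ(n)χ(n) n^{-1/2} log(x/n)` at `y = x` and `y = xe²`: discharge of `Suzuki2025Chebyshev_thm7`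

M. Suzuki, *On variants of Chebyshev's conjecture*, Ramanujan J. **68** (2025), no. 4, art. 95 = arXiv:2411.07436
[`Suzuki2025Chebyshev`; PUBLISHED, refereed], **Theorem 7** (§1.3, (1.26)–(1.27)), AS TYPED in
`ChebyshevHalfLineBiasVariants.lean` (RH literature-typing tranche 1; clause (1.27) under the hypothesis
`Q ≥ xe²` that the printed proof establishes, see the docstring of the named fact). This file DISCHARGES the
named fact: `Suzuki2025Chebyshev_thm7_holds`. The statement is UNCONDITIONAL and elementary («we find that
(1.22) is unconditionally negative on average», p. 5): no zeros of `ζ` or of any `L(s, χ)` enter, and nothing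
here is, or is worded as, progress toward RH or GRH. Theorems only: no definitions, no named facts
(D-0014/D-0026).

## The printed proof (§5.2) and this formalisation

§5.2 proves (1.26) in four moves, each mirrored by one lemma of the sub-namespace
`ChebyshevHalfLineBiasThm7` (same order):

1. *Orthogonality* (§5.1, first display): `Σ_{χ mod q} χ(n) = φ(q) [n ≡ 1 (q)]`, so the character sum is
   `φ(q) Σ_{n ≤ y, n ≡ 1 (q)} Λ(n) n^{-1/2} log(x/n)` — `charHalfLineBiasSum_eq` (Mathlib
   `DirichletCharacter.sum_characters_eq`).
2. *Summing the moduli and `Σ_{d ∣ m} φ(d) = m`* ((5.10) and the display after it): for `n ≤ y ≤ Q` all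
   divisors of `n − 1` lie in `[1, Q]`, the divisors `1, 2` are excluded (`2 ∣ p^k − 1` iff `p` odd), hence
   `Σ_{3 ≤ q ≤ Q, q ∣ n−1} φ(q) = n − 2 − [2 ∣ n − 1]` (the paper's `n − 3` for `n ∉ 2^ℕ`, `n − 2` for `n = 2^k`)
   — `sum_Icc_totient_dvd` (Mathlib `Nat.sum_totient`) and `sum_range_charHalfLineBiasSum_eq`; the term
   `n = 1` carries `Λ(1) = 0`.
3. *The secondary terms* `Σ_{n ≤ y} Λ(n) n^{-1/2} log(x/n) · O(1)`: the paper quotes `O(√x)` from [Su23] and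
   the prime number theorem; here the cruder `Λ(n) ≤ log n` bound `≤ 3 y log y (|log x| + log y) = o(x√x)`
   suffices (`abs_sum_secondary_le`, `isLittleO_secondary_self`, `isLittleO_secondary_exp_two`) — a
   deliberate shortcut, the only deviation from the printed road.
4. *Partial summation with the prime number theorem* (the two displays «By applying partial summation …»):
   `Σ_{n ≤ y} Λ(n)√n (log y + c − log n) = (2c/3 + 4/9) y√y + o(y√y)` for fixed `c`
   (`sum_vonMangoldt_sqrt_weight_isLittleO`; `c = 0` gives the printed `(4/9)x√x`, `c = −2` the printed
   `−(8/9)x√x`, and «substituting `xe²` for `x`» is the composition with `x ↦ xe²`). The engine is Abel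
   summation through `ψ` plus an integration by parts,
   `Σ_{a < n ≤ b} f(n)Λ(n) − ∫_a^b f = f(b)(ψ(b) − b) − f(a)(ψ(a) − a) − ∫_a^b f'(t)(ψ(t) − t) dt`
   (`sum_vonMangoldt_mul_sub_integral_eq`, the `ψ`-twin of the tree's `θ`-version
   `Literature.NumberTheory.LFunctions.sum_prime_mul_log_sub_integral_eq` in `PrimeSumSmoothWeight.lean`;
   Mathlib `sum_mul_eq_sub_sub_integral_mul`), applied to `f(t) = √t (log y + c − log t)` with the explicit
   primitive `t√t (2/3 (log y + c − log t) + 4/9)`, and the prime number theorem `ψ(t) = t + o(t)`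
   (`Literature.NumberTheory.LFunctions.chebyshevPsi_isEquivalent_holds`, packaged as
   `|ψ(t) − t| ≤ K + ε't` for all `t ≥ 0` in `exists_psi_sub_le`); the remainder integral is bounded in
   `abs_integral_weightDeriv_mul_le` (the cancellation `log y − log t = log(y/t)` is kept against the `ε't`
   part, so that the error is `o(y√y)` and not `o(y√y log y)`).

The assembly `Suzuki2025Chebyshev_thm7_holds` is then the algebra
`Σ_{3≤q≤Q}(… − 4√x) − 4√x(x/9 − Q) = [Σ Λ√n log(x/n) − (4/9)x√x] − [secondary] + 8√x` for (1.26) and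
`Σ_{3≤q≤Q} … + (8/9)e³x√x = [Σ_{n ≤ xe²} Λ√n log(x/n) + (8/9)(xe²)^{3/2}] − [secondary]` for (1.27)
(`√(e²) = e`), each bracket being `o(x√x)`.

## References

* M. Suzuki, *On variants of Chebyshev's conjecture*, Ramanujan J. **68** (2025), art. 95,
  doi:10.1007/s11139-025-01238-9, arXiv:2411.07436 — Thm 7 (§1.3), proof §5.2. [Suzuki2025Chebyshev]
* H. L. Montgomery, R. C. Vaughan, *Multiplicative Number Theory I. Classical Theory*, CUP 2007, §2.1
  (Abel summation), §8.1 eq. (8.2) (`ψ(x) = x + o(x)`). [MontgomeryVaughan2007]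
-/

open Finset Real MeasureTheory Set intervalIntegral Filter Asymptotics
open scoped Chebyshev ArithmeticFunction.vonMangoldt

noncomputable section

namespace Literature.NumberTheory.LFunctions

namespace ChebyshevHalfLineBiasThm7

/-- **Abel summation through `ψ` and integration by parts.** For `0 ≤ a ≤ b` and `f` with a continuous
derivative `f'` on `[a, b]`,
`∑_{⌊a⌋ < n ≤ ⌊b⌋} f(n) Λ(n) − ∫_a^b f = f(b)(ψ(b) − b) − f(a)(ψ(a) − a) − ∫_a^b f'(t)(ψ(t) − t) dt`
(the `ψ`-twin of `sum_prime_mul_log_sub_integral_eq`). [cite: MontgomeryVaughan2007, §2.1 (Abel summation)] -/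
theorem sum_vonMangoldt_mul_sub_integral_eq {f f' : ℝ → ℝ} {a b : ℝ} (ha : 0 ≤ a) (hab : a ≤ b)
    (hf : ∀ t ∈ Icc a b, HasDerivAt f (f' t) t) (hf' : ContinuousOn f' (Icc a b)) :
    ∑ n ∈ Finset.Ioc ⌊a⌋₊ ⌊b⌋₊, f n * Λ n - ∫ t in a..b, f t =
      f b * (ψ b - b) - f a * (ψ a - a) - ∫ t in a..b, f' t * (ψ t - t) := by
  set c : ℕ → ℝ := fun k => Λ k with hc
  have hderiv : ∀ t ∈ Icc a b, deriv f t = f' t := fun t ht => (hf t ht).deriv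
  have hf_diff : ∀ t ∈ Icc a b, DifferentiableAt ℝ f t := fun t ht => (hf t ht).differentiableAt
  have hf'_int : IntegrableOn f' (Icc a b) := hf'.integrableOn_Icc
  have hderiv_int : IntegrableOn (deriv f) (Icc a b) :=
    hf'_int.congr_fun (fun t ht => (hderiv t ht).symm) measurableSet_Icc
  have habel := sum_mul_eq_sub_sub_integral_mul c ha hab hf_diff hderiv_int
  simp only [hc, ← Chebyshev.psi_eq_sum_Icc] at habel
  -- the integral in Abel's identity
  have hint_eq : ∫ t in Ioc a b, deriv f t * ψ t = ∫ t in a..b, f' t * ψ t := by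
    rw [intervalIntegral.integral_of_le hab]
    refine setIntegral_congr_fun measurableSet_Ioc fun t ht => ?_
    rw [hderiv t (Ioc_subset_Icc_self ht)]
  -- integration by parts `∫ f = b f(b) − a f(a) − ∫ t f'(t) dt`
  have huIcc : uIcc a b = Icc a b := uIcc_of_le hab
  have hf'_ii : IntervalIntegrable f' volume a b := (hf'.mono huIcc.subset).intervalIntegrable
  have hIBP : ∫ t in a..b, f t = f b * b - f a * a - ∫ t in a..b, f' t * t := by
    have h := intervalIntegral.integral_mul_deriv_eq_deriv_mul (u := f) (v := id) (u' := f')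
      (v' := fun _ => (1 : ℝ)) (fun t ht => hf t (huIcc ▸ ht)) (fun t _ => hasDerivAt_id t)
      hf'_ii intervalIntegrable_const
    simpa only [id, mul_one] using h
  -- integrability of `f' ψ` and `f' · t`
  have hψ_int : IntervalIntegrable (fun t => f' t * ψ t) volume a b := by
    rw [intervalIntegrable_iff_integrableOn_Icc_of_le hab]
    have h := integrableOn_mul_sum_Icc c ha (m := 0) hf'_int
    simp only [hc, ← Chebyshev.psi_eq_sum_Icc] at h
    exact h
  have hid_int : IntervalIntegrable (fun t => f' t * t) volume a b :=
    ((hf'.mul continuousOn_id).mono huIcc.subset).intervalIntegrable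
  have hsplit : ∫ t in a..b, f' t * (ψ t - t) =
      (∫ t in a..b, f' t * ψ t) - ∫ t in a..b, f' t * t := by
    rw [← intervalIntegral.integral_sub hψ_int hid_int]
    refine intervalIntegral.integral_congr fun t _ => ?_
    ring
  rw [hint_eq] at habel
  rw [habel, hIBP, hsplit]
  ring

/-- `t ↦ f'(t)(ψ(t) − t)` is interval integrable on `[a, b]` for `f'` continuous there. [folklore] -/
private theorem intervalIntegrable_mul_psi_sub {f' : ℝ → ℝ} {a b : ℝ} (ha : 0 ≤ a) (hab : a ≤ b)
    (hf' : ContinuousOn f' (Icc a b)) :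
    IntervalIntegrable (fun t => f' t * (ψ t - t)) volume a b := by
  have huIcc : uIcc a b = Icc a b := uIcc_of_le hab
  have hf'_int : IntegrableOn f' (Icc a b) := hf'.integrableOn_Icc
  have hψ_int : IntervalIntegrable (fun t => f' t * ψ t) volume a b := by
    rw [intervalIntegrable_iff_integrableOn_Icc_of_le hab]
    have h := integrableOn_mul_sum_Icc (fun k : ℕ => (Λ k : ℝ)) ha (m := 0) hf'_int
    simp only [← Chebyshev.psi_eq_sum_Icc] at h
    exact h
  have hid_int : IntervalIntegrable (fun t => f' t * t) volume a b :=
    ((hf'.mul continuousOn_id).mono huIcc.subset).intervalIntegrable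
  have : (fun t => f' t * (ψ t - t)) = fun t => f' t * ψ t - f' t * t := by funext t; ring
  rw [this]
  exact hψ_int.sub hid_int

/-- The weight `t ↦ √t (L − log t)` has derivative `(L − log t − 2)/(2√t)` at `t > 0`. [folklore] -/
private theorem hasDerivAt_weight (L : ℝ) {t : ℝ} (ht : 0 < t) :
    HasDerivAt (fun u : ℝ => √u * (L - Real.log u)) ((L - Real.log t - 2) / (2 * √t)) t := by
  have h1 : HasDerivAt (fun u : ℝ => √u) (1 / (2 * √t)) t := Real.hasDerivAt_sqrt ht.ne'
  have h2 : HasDerivAt (fun u : ℝ => L - Real.log u) (-(t⁻¹)) t := by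
    simpa using (Real.hasDerivAt_log ht.ne').const_sub L
  have h := h1.mul h2
  have hst : 0 < √t := Real.sqrt_pos.2 ht
  have key : 1 / (2 * √t) * (L - Real.log t) + √t * -t⁻¹ = (L - Real.log t - 2) / (2 * √t) := by
    field_simp
    rw [Real.sq_sqrt ht.le]
    ring
  rw [key] at h
  exact h

/-- The primitive `F_L(t) = t√t (2/3 (L − log t) + 4/9)` of the weight: `F_L' = √t (L − log t)` at `t > 0`.
[folklore] -/
private theorem hasDerivAt_primitive (L : ℝ) {t : ℝ} (ht : 0 < t) :
    HasDerivAt (fun u : ℝ => u * √u * (2 / 3 * (L - Real.log u) + 4 / 9))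
      (√t * (L - Real.log t)) t := by
  have h1 : HasDerivAt (fun u : ℝ => u * √u) (1 * √t + t * (1 / (2 * √t))) t :=
    (hasDerivAt_id t).mul (Real.hasDerivAt_sqrt ht.ne')
  have h2 : HasDerivAt (fun u : ℝ => 2 / 3 * (L - Real.log u) + 4 / 9) (2 / 3 * (-(t⁻¹))) t := by
    have := ((Real.hasDerivAt_log ht.ne').const_sub L).const_mul (2 / 3 : ℝ)
    simpa using this.add_const (4 / 9 : ℝ)
  have h := h1.mul h2
  have hst : 0 < √t := Real.sqrt_pos.2 ht
  have key : (1 * √t + t * (1 / (2 * √t))) * (2 / 3 * (L - Real.log t) + 4 / 9)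
      + t * √t * (2 / 3 * (-(t⁻¹))) = √t * (L - Real.log t) := by
    field_simp
    rw [Real.sq_sqrt ht.le]
    ring
  rw [key] at h
  exact h


/-- The derivative `(L − log u − 2)/(2√u)` of the weight is continuous on `[1, y]`. [folklore] -/
private theorem continuousOn_weightDeriv (L y : ℝ) :
    ContinuousOn (fun u : ℝ => (L - Real.log u - 2) / (2 * √u)) (Icc (1 : ℝ) y) := by
  have h0 : ∀ u ∈ Icc (1 : ℝ) y, u ≠ 0 := fun u hu => by linarith [hu.1]
  refine ContinuousOn.div ?_ ?_ ?_
  · exact ((continuousOn_const.sub (Real.continuousOn_log.mono h0)).sub continuousOn_const)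
  · exact continuousOn_const.mul Real.continuous_sqrt.continuousOn
  · intro u hu
    have : 0 < √u := Real.sqrt_pos.2 (by linarith [hu.1])
    positivity

/-- `y log y`-type lower-order terms are eventually below `δ · y√y`. [folklore] -/
private theorem lower_order_eventually (c K : ℝ) (hK : 0 ≤ K) {δ : ℝ} (hδ : 0 < δ) :
    ∀ᶠ y : ℝ in atTop,
      (Real.log y + |c|) / 3 + 4 / 9 + |c| * K * √y + (Real.log y + |c| + 2) / 2 * K * y
        ≤ δ * (y * √y) := by
  -- everything is `≤ C · y log y` for `y ≥ 3`, and `y log y = o(y √y)`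
  set C : ℝ := (1 + |c|) / 3 + 4 / 9 + |c| * K + (3 + |c|) / 2 * K with hC
  have hC0 : 0 ≤ C := by positivity
  have hlog : Real.log =o[atTop] fun y : ℝ => √y :=
    (isLittleO_log_rpow_atTop (by norm_num : (0 : ℝ) < 1 / 2)).congr_right
      fun y => (Real.sqrt_eq_rpow y).symm
  have hylog : (fun y : ℝ => y * Real.log y) =o[atTop] fun y : ℝ => y * √y :=
    (isBigO_refl (fun y : ℝ => y) atTop).mul_isLittleO hlog
  have hδC : 0 < δ / (C + 1) := by positivity
  filter_upwards [hylog.def hδC, eventually_ge_atTop (3 : ℝ)] with y hy hy3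
  have hy1 : 1 ≤ y := by linarith
  have hy0 : 0 ≤ y := by linarith
  have hlog1 : 1 ≤ Real.log y := by
    rw [← Real.log_exp 1]
    refine Real.log_le_log (Real.exp_pos 1) ?_
    have := Real.exp_one_lt_d9
    linarith
  have hlog0 : 0 ≤ Real.log y := by linarith
  have hyly1 : 1 ≤ y * Real.log y := one_le_mul_of_one_le_of_one_le hy1 hlog1
  have hyly : 0 ≤ y * Real.log y := by positivity
  have hyy : y ≤ y * Real.log y := by
    have := mul_le_mul_of_nonneg_left hlog1 hy0
    linarith
  have hsy : √y ≤ y := by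
    rw [Real.sqrt_le_iff]
    refine ⟨hy0, ?_⟩
    have := mul_le_mul_of_nonneg_left hy1 hy0
    rw [sq]; linarith
  rw [Real.norm_of_nonneg hyly, Real.norm_of_nonneg (by positivity)] at hy
  -- term by term
  have h1 : (Real.log y + |c|) / 3 ≤ (1 + |c|) / 3 * (y * Real.log y) := by
    have ha : Real.log y ≤ y * Real.log y := by
      have := mul_le_mul_of_nonneg_right hy1 hlog0
      linarith
    have hb : |c| ≤ |c| * (y * Real.log y) := by
      have := mul_le_mul_of_nonneg_left hyly1 (abs_nonneg c)
      linarith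
    linarith
  have h2 : (4 : ℝ) / 9 ≤ 4 / 9 * (y * Real.log y) := by linarith
  have h3 : |c| * K * √y ≤ |c| * K * (y * Real.log y) :=
    mul_le_mul_of_nonneg_left (hsy.trans hyy) (by positivity)
  have h4 : (Real.log y + |c| + 2) / 2 * K * y ≤ (3 + |c|) / 2 * K * (y * Real.log y) := by
    have ha : Real.log y + |c| + 2 ≤ (3 + |c|) * Real.log y := by
      have := mul_le_mul_of_nonneg_left hlog1 (abs_nonneg c)
      linarith
    have := mul_le_mul_of_nonneg_left ha (by positivity : 0 ≤ K * y / 2)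
    linarith
  have hsum : (Real.log y + |c|) / 3 + 4 / 9 + |c| * K * √y + (Real.log y + |c| + 2) / 2 * K * y
      ≤ C * (y * Real.log y) := by rw [hC]; linarith
  have hfin : C * (y * Real.log y) ≤ δ * (y * √y) := by
    calc C * (y * Real.log y) ≤ C * (δ / (C + 1) * (y * √y)) :=
          mul_le_mul_of_nonneg_left hy hC0
      _ = (C / (C + 1)) * (δ * (y * √y)) := by ring
      _ ≤ 1 * (δ * (y * √y)) := by
          refine mul_le_mul_of_nonneg_right ?_ (by positivity)
          rw [div_le_one (by positivity)]; linarith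
      _ = δ * (y * √y) := one_mul _
  linarith

/-- The prime number theorem in the form used here: for every `ε' > 0` there are `T ≥ 1` and
`K ≥ 0` with `|ψ(t) − t| ≤ K + ε' t` for all `t ≥ 0`, and `T` a threshold beyond which
`|ψ(t) − t| ≤ ε' t`. [cite: MontgomeryVaughan2007, §8.1 eq. (8.2)] -/
theorem exists_psi_sub_le {ε' : ℝ} (hε' : 0 < ε') :
    ∃ T K : ℝ, 1 ≤ T ∧ 0 ≤ K ∧ ∀ t : ℝ, 0 ≤ t → |ψ t - t| ≤ K + ε' * t := by
  have hPNT : (fun t : ℝ => ψ t - t) =o[atTop] fun t : ℝ => t := by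
    have h := chebyshevPsi_isEquivalent_holds
    unfold chebyshevPsi_isEquivalent at h
    exact h.isLittleO
  have h := hPNT.def hε'
  rw [Filter.eventually_atTop] at h
  obtain ⟨T₀, hT₀⟩ := h
  set T : ℝ := max T₀ 1 with hT
  have hT1 : 1 ≤ T := le_max_right _ _
  refine ⟨T, ψ T + T, hT1, add_nonneg (Chebyshev.psi_nonneg T) (by linarith), fun t ht => ?_⟩
  rcases le_or_gt T t with hTt | htT
  · have h1 := hT₀ t ((le_max_left _ _).trans hTt)
    rw [Real.norm_eq_abs, Real.norm_eq_abs, abs_of_nonneg ht] at h1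
    linarith [Chebyshev.psi_nonneg T, mul_nonneg hε'.le ht]
  · have h1 : |ψ t - t| ≤ ψ t + t := by
      rw [abs_le]; constructor <;> linarith [Chebyshev.psi_nonneg t]
    have h2 : ψ t ≤ ψ T := Chebyshev.psi_mono htT.le
    have h3 : 0 ≤ ε' * t := by positivity
    linarith

/-- **The Abel remainder integral.** With `|ψ(t) − t| ≤ K + ε' t` (`t ≥ 0`), for `y ≥ 1`:
`|∫_1^y (log y + c − log t − 2)/(2√t) · (ψ(t) − t) dt| ≤ (log y + |c| + 2)/2 · K · y + ε' (|c − 2|/3 + 2/9) y√y`.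
[cite: Suzuki2025Chebyshev, §5.2 (partial summation step)] -/
theorem abs_integral_weightDeriv_mul_le (c : ℝ) {ε' K y : ℝ} (hε' : 0 < ε') (hK : 0 ≤ K)
    (hE : ∀ t : ℝ, 0 ≤ t → |ψ t - t| ≤ K + ε' * t) (hy1 : 1 ≤ y) :
    |∫ t in (1 : ℝ)..y, (Real.log y + c - Real.log t - 2) / (2 * √t) * (ψ t - t)|
      ≤ (Real.log y + |c| + 2) / 2 * K * y + ε' * (|c - 2| / 3 + 2 / 9) * (y * √y) := by
  have hlogy0 : 0 ≤ Real.log y := Real.log_nonneg hy1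
  set L : ℝ := Real.log y + c with hL
  set f' : ℝ → ℝ := fun u => (L - Real.log u - 2) / (2 * √u) with hf'
  have hf'_cont : ContinuousOn f' (Icc (1 : ℝ) y) := continuousOn_weightDeriv L y
  set B : ℝ := (Real.log y + |c| + 2) / 2 with hB
  set M : ℝ := Real.log y + |c - 2| with hM
  have hB0 : 0 ≤ B := by positivity
  have hM0 : 0 ≤ M := by positivity
  have hEint : IntervalIntegrable (fun t => f' t * (ψ t - t)) volume 1 y :=
    intervalIntegrable_mul_psi_sub zero_le_one hy1 hf'_cont
  have hg_cont : ContinuousOn (fun t : ℝ => B * K + ε' / 2 * (√t * (M - Real.log t)))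
      (Icc (1 : ℝ) y) := by
    have h0 : ∀ u ∈ Icc (1 : ℝ) y, u ≠ 0 := fun u hu => by linarith [hu.1]
    exact continuousOn_const.add (continuousOn_const.mul
      (Real.continuous_sqrt.continuousOn.mul
        (continuousOn_const.sub (Real.continuousOn_log.mono h0))))
  have hgi : IntervalIntegrable (fun t : ℝ => B * K + ε' / 2 * (√t * (M - Real.log t)))
      volume 1 y := (hg_cont.mono (uIcc_of_le hy1).subset).intervalIntegrable
  have hpt : ∀ t ∈ Icc (1 : ℝ) y,
      |f' t * (ψ t - t)| ≤ B * K + ε' / 2 * (√t * (M - Real.log t)) := by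
    intro t ht
    have ht0 : 0 < t := by linarith [ht.1]
    have hst1 : 1 ≤ √t := by
      have := Real.sqrt_le_sqrt ht.1
      rwa [Real.sqrt_one] at this
    have hst0 : 0 < √t := by linarith
    have hss : √t * √t = t := Real.mul_self_sqrt ht0.le
    have hlogt0 : 0 ≤ Real.log t := Real.log_nonneg ht.1
    have hlogty : Real.log t ≤ Real.log y := Real.log_le_log ht0 ht.2
    have hEt := hE t ht0.le
    have hnum : |L - Real.log t - 2| ≤ (Real.log y - Real.log t) + |c - 2| := by
      have : L - Real.log t - 2 = (Real.log y - Real.log t) + (c - 2) := by rw [hL]; ring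
      rw [this]
      calc |(Real.log y - Real.log t) + (c - 2)| ≤ |Real.log y - Real.log t| + |c - 2| :=
            abs_add_le _ _
        _ = (Real.log y - Real.log t) + |c - 2| := by rw [abs_of_nonneg (by linarith)]
    have hf't : |f' t| = |L - Real.log t - 2| / (2 * √t) := by
      simp only [hf']
      rw [abs_div, abs_of_pos (by positivity : (0 : ℝ) < 2 * √t)]
    have hi : |f' t| ≤ B := by
      rw [hf't, div_le_iff₀ (by positivity)]
      have h1 : |L - Real.log t - 2| ≤ Real.log y + |c| + 2 := by
        have : |c - 2| ≤ |c| + 2 := by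
          calc |c - 2| ≤ |c| + |(2 : ℝ)| := abs_sub c 2
            _ = |c| + 2 := by norm_num
        linarith
      have h2 : Real.log y + |c| + 2 ≤ B * (2 * √t) := by
        have h3 : 0 ≤ Real.log y + |c| + 2 := by positivity
        have := mul_le_mul_of_nonneg_left hst1 h3
        rw [hB]; linarith
      linarith
    have hii : |f' t| * t ≤ √t * (M - Real.log t) / 2 := by
      rw [hf't]
      have hq : |L - Real.log t - 2| / (2 * √t) * t = |L - Real.log t - 2| * √t / 2 := by
        rw [div_mul_eq_mul_div, div_eq_div_iff (by positivity) (by norm_num)]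
        linear_combination (-2 * |L - Real.log t - 2|) * hss
      rw [hq]
      have hM' : |L - Real.log t - 2| ≤ M - Real.log t := by rw [hM]; linarith
      have := mul_le_mul_of_nonneg_right hM' hst0.le
      linarith
    calc |f' t * (ψ t - t)| = |f' t| * |ψ t - t| := abs_mul _ _
      _ ≤ |f' t| * (K + ε' * t) := mul_le_mul_of_nonneg_left hEt (abs_nonneg _)
      _ = |f' t| * K + ε' * (|f' t| * t) := by ring
      _ ≤ B * K + ε' * (√t * (M - Real.log t) / 2) := by
          gcongr
      _ = B * K + ε' / 2 * (√t * (M - Real.log t)) := by ring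
  have hmono := intervalIntegral.integral_mono_on hy1 hEint.abs hgi hpt
  have hG : ∫ t in (1 : ℝ)..y, (B * K + ε' / 2 * (√t * (M - Real.log t)))
      = B * K * (y - 1)
        + ε' / 2 * ((2 / 3 * |c - 2| + 4 / 9) * (y * √y) - (2 / 3 * M + 4 / 9)) := by
    have hGd : ∀ t ∈ uIcc (1 : ℝ) y,
        HasDerivAt (fun u : ℝ => B * K * u
          + ε' / 2 * (u * √u * (2 / 3 * (M - Real.log u) + 4 / 9)))
          (B * K + ε' / 2 * (√t * (M - Real.log t))) t := by
      intro t ht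
      rw [uIcc_of_le hy1] at ht
      have ht0 : 0 < t := by linarith [ht.1]
      have h1 : HasDerivAt (fun u : ℝ => B * K * u) (B * K) t := by
        simpa using (hasDerivAt_id t).const_mul (B * K)
      exact h1.add ((hasDerivAt_primitive M ht0).const_mul (ε' / 2))
    rw [intervalIntegral.integral_eq_sub_of_hasDerivAt hGd hgi]
    have hMy : M - Real.log y = |c - 2| := by rw [hM]; ring
    simp only [Real.sqrt_one, Real.log_one, mul_one, sub_zero, hMy]
    ring
  calc |∫ t in (1 : ℝ)..y, f' t * (ψ t - t)|
      ≤ ∫ t in (1 : ℝ)..y, |f' t * (ψ t - t)| :=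
        intervalIntegral.abs_integral_le_integral_abs hy1
    _ ≤ ∫ t in (1 : ℝ)..y, (B * K + ε' / 2 * (√t * (M - Real.log t))) := hmono
    _ = B * K * (y - 1)
        + ε' / 2 * ((2 / 3 * |c - 2| + 4 / 9) * (y * √y) - (2 / 3 * M + 4 / 9)) := hG
    _ ≤ B * K * y + ε' * (|c - 2| / 3 + 2 / 9) * (y * √y) := by
        have h1 : 0 ≤ B * K := by positivity
        have h2 : 0 ≤ ε' / 2 * (2 / 3 * M + 4 / 9) := by positivity
        linarith

/-- **The Abel remainder, exactly.** For `y ≥ 1`,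
`Σ_{n ≤ y} Λ(n)√n (log y + c − log n) − (2c/3 + 4/9) y√y
 = (log y + c)/3 − 4/9 + c√y (ψ(y) − y) − ∫_1^y (log y + c − log t − 2)/(2√t) (ψ(t) − t) dt`.
[cite: Suzuki2025Chebyshev, §5.2 (partial summation step)] -/
theorem sum_sub_main_eq (c : ℝ) {y : ℝ} (hy1 : 1 ≤ y) :
    ∑ n ∈ Finset.Icc 1 ⌊y⌋₊, Λ n * √(n : ℝ) * (Real.log y + c - Real.log n)
        - (2 / 3 * c + 4 / 9) * (y * √y)
      = (Real.log y + c) / 3 - 4 / 9 + √y * c * (ψ y - y)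
        - ∫ t in (1 : ℝ)..y, (Real.log y + c - Real.log t - 2) / (2 * √t) * (ψ t - t) := by
  have hy0 : 0 < y := by linarith
  set L : ℝ := Real.log y + c with hL
  set f : ℝ → ℝ := fun u => √u * (L - Real.log u) with hf
  set f' : ℝ → ℝ := fun u => (L - Real.log u - 2) / (2 * √u) with hf'
  have hderiv : ∀ t ∈ Icc (1 : ℝ) y, HasDerivAt f (f' t) t := fun t ht =>
    hasDerivAt_weight L (lt_of_lt_of_le zero_lt_one ht.1)
  have hf'_cont : ContinuousOn f' (Icc (1 : ℝ) y) := continuousOn_weightDeriv L y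
  have hf_cont : ContinuousOn f (Icc (1 : ℝ) y) := fun t ht =>
    (hderiv t ht).continuousAt.continuousWithinAt
  have hAbel := sum_vonMangoldt_mul_sub_integral_eq zero_le_one hy1 hderiv hf'_cont
  rw [Nat.floor_one] at hAbel
  have hsum : ∑ n ∈ Finset.Icc 1 ⌊y⌋₊, Λ n * √(n : ℝ) * (Real.log y + c - Real.log n)
      = ∑ n ∈ Finset.Ioc 1 ⌊y⌋₊, f n * Λ n := by
    have h1 : 1 ≤ ⌊y⌋₊ := by
      rw [Nat.one_le_floor_iff]; exact hy1
    rw [Finset.Icc_eq_cons_Ioc h1, Finset.sum_cons]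
    simp only [Nat.cast_one, ArithmeticFunction.vonMangoldt_apply_one, zero_mul, zero_add]
    refine Finset.sum_congr rfl fun n _ => ?_
    simp only [hf, hL]
    ring
  have hFTC : ∫ t in (1 : ℝ)..y, f t = (2 / 3 * c + 4 / 9) * (y * √y) - (2 / 3 * L + 4 / 9) := by
    have hF : ∀ t ∈ uIcc (1 : ℝ) y,
        HasDerivAt (fun u : ℝ => u * √u * (2 / 3 * (L - Real.log u) + 4 / 9)) (f t) t := by
      intro t ht
      rw [uIcc_of_le hy1] at ht
      exact hasDerivAt_primitive L (by linarith [ht.1])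
    have hfi : IntervalIntegrable f volume 1 y :=
      (hf_cont.mono (uIcc_of_le hy1).subset).intervalIntegrable
    rw [intervalIntegral.integral_eq_sub_of_hasDerivAt hF hfi]
    have hlogy : L - Real.log y = c := by rw [hL]; ring
    simp only [Real.sqrt_one, Real.log_one, mul_one, one_mul, sub_zero, hlogy]
    ring
  have hfy : f y = √y * c := by
    simp only [hf, hL]; ring
  have hf1 : f 1 = L := by simp [hf]
  have hψ1 : ψ (1 : ℝ) = 0 := Chebyshev.psi_eq_zero_of_lt_two (by norm_num)
  rw [hsum]
  have h := hAbel
  rw [hFTC, hfy, hf1, hψ1] at h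
  linarith

/-- **Main term.** For fixed `c`, `Σ_{n ≤ y} Λ(n) √n (log y + c − log n) = (2c/3 + 4/9) y√y + o(y√y)`
(Abel summation against `√t (log y + c − log t)` and the prime number theorem `ψ(t) ∼ t`).
At `c = 0` this is the printed `Σ_{n ≤ x} Λ(n)√n log(x/n) = (4/9) x√x (1 + o(1))`, at `c = −2` the
printed `Σ_{n ≤ x} Λ(n)√n log(x/(ne²)) = −(8/9) x√x (1 + o(1))`.
[cite: Suzuki2025Chebyshev, §5.2 (the two partial-summation displays)] -/
theorem sum_vonMangoldt_sqrt_weight_isLittleO (c : ℝ) :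
    (fun y : ℝ => ∑ n ∈ Finset.Icc 1 ⌊y⌋₊, Λ n * √(n : ℝ) * (Real.log y + c - Real.log n)
        - (2 / 3 * c + 4 / 9) * (y * √y)) =o[atTop] fun y : ℝ => y * √y := by
  refine Asymptotics.isLittleO_iff.2 fun ε hε => ?_
  set A : ℝ := |c| + |c - 2| / 3 + 2 / 9 + 1 with hA
  have hA0 : 0 < A := by positivity
  obtain ⟨ε', hε'0, hε'A⟩ : ∃ ε' : ℝ, 0 < ε' ∧ ε' * A ≤ ε / 2 :=
    ⟨ε / 2 / A, by positivity, by rw [div_mul_cancel₀ _ hA0.ne']⟩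
  obtain ⟨T, K, hT1, hK0, hE⟩ := exists_psi_sub_le hε'0
  filter_upwards [lower_order_eventually c K hK0 (half_pos hε), eventually_ge_atTop T]
    with y hylow hyT
  have hy1 : 1 ≤ y := hT1.trans hyT
  have hy0 : 0 < y := by linarith
  have hlogy0 : 0 ≤ Real.log y := Real.log_nonneg hy1
  have hys0 : 0 ≤ y * √y := by positivity
  rw [sum_sub_main_eq c hy1, Real.norm_eq_abs, Real.norm_eq_abs, abs_of_nonneg hys0]
  have hIbound := abs_integral_weightDeriv_mul_le c hε'0 hK0 hE hy1
  have hEy : |√y * c * (ψ y - y)| ≤ |c| * K * √y + ε' * |c| * (y * √y) := by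
    rw [abs_mul, abs_mul, abs_of_nonneg (Real.sqrt_nonneg y)]
    have h := hE y hy0.le
    have hs : 0 ≤ √y * |c| := by positivity
    calc √y * |c| * |ψ y - y| ≤ √y * |c| * (K + ε' * y) := mul_le_mul_of_nonneg_left h hs
      _ = |c| * K * √y + ε' * |c| * (y * √y) := by ring
  have hLb : |(Real.log y + c) / 3 - 4 / 9| ≤ (Real.log y + |c|) / 3 + 4 / 9 := by
    have h1 : |Real.log y + c| ≤ Real.log y + |c| := by
      calc |Real.log y + c| ≤ |Real.log y| + |c| := abs_add_le _ _
        _ = Real.log y + |c| := by rw [abs_of_nonneg hlogy0]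
    calc |(Real.log y + c) / 3 - 4 / 9| ≤ |(Real.log y + c) / 3| + |(4 : ℝ) / 9| := abs_sub _ _
      _ = |Real.log y + c| / 3 + 4 / 9 := by
          rw [abs_div, abs_of_pos (by norm_num : (0 : ℝ) < 3)]; norm_num
      _ ≤ (Real.log y + |c|) / 3 + 4 / 9 := by linarith
  have hcoef : ε' * (|c| + (|c - 2| / 3 + 2 / 9)) * (y * √y) ≤ ε' * A * (y * √y) := by
    apply mul_le_mul_of_nonneg_right _ hys0
    exact mul_le_mul_of_nonneg_left (by rw [hA]; linarith) hε'0.le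
  have hfin : ε' * A * (y * √y) ≤ ε / 2 * (y * √y) := mul_le_mul_of_nonneg_right hε'A hys0
  calc |(Real.log y + c) / 3 - 4 / 9 + √y * c * (ψ y - y)
        - ∫ t in (1 : ℝ)..y, (Real.log y + c - Real.log t - 2) / (2 * √t) * (ψ t - t)|
      ≤ |(Real.log y + c) / 3 - 4 / 9| + |√y * c * (ψ y - y)|
        + |∫ t in (1 : ℝ)..y, (Real.log y + c - Real.log t - 2) / (2 * √t) * (ψ t - t)| := by
        have h1 := abs_add_le ((Real.log y + c) / 3 - 4 / 9) (√y * c * (ψ y - y))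
        have h2 := abs_sub ((Real.log y + c) / 3 - 4 / 9 + √y * c * (ψ y - y))
          (∫ t in (1 : ℝ)..y, (Real.log y + c - Real.log t - 2) / (2 * √t) * (ψ t - t))
        linarith
    _ ≤ ((Real.log y + |c|) / 3 + 4 / 9 + |c| * K * √y + (Real.log y + |c| + 2) / 2 * K * y)
        + ε' * (|c| + (|c - 2| / 3 + 2 / 9)) * (y * √y) := by
        linarith
    _ ≤ ε / 2 * (y * √y) + ε / 2 * (y * √y) := by linarith
    _ = ε * (y * √y) := by ring
/-- Re-indexing the moduli: `Σ_{m < Q − 2} g(m + 3) = Σ_{3 ≤ q ≤ Q} g(q)`. [folklore] -/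
private theorem sum_range_sub_two {M : Type*} [AddCommMonoid M] (g : ℕ → M) (Q : ℕ) :
    ∑ m ∈ Finset.range (Q - 2), g (m + 3) = ∑ q ∈ Finset.Icc 3 Q, g q := by
  rcases lt_or_ge Q 2 with hQ | hQ
  · have h1 : Q - 2 = 0 := by omega
    have h2 : Finset.Icc 3 Q = ∅ := Finset.Icc_eq_empty (by omega)
    simp [h1, h2]
  · rw [Finset.range_eq_Ico, Finset.sum_Ico_add' g 0 (Q - 2) 3]
    have h : Finset.Ico (0 + 3) (Q - 2 + 3) = Finset.Icc 3 Q := by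
      ext q
      simp only [Finset.mem_Ico, Finset.mem_Icc]
      omega
    rw [h]

/-- Orthogonality of characters inside `charHalfLineBiasSum`:
`Σ_χ Σ_n Λ(n)χ(n) n^{-1/2} log(x/n) = Σ_n φ(q)[n ≡ 1 (q)] Λ(n) n^{-1/2} log(x/n)`.
[cite: Suzuki2025Chebyshev, §5.1 (orthogonality display)] -/
theorem charHalfLineBiasSum_eq (q : ℕ) [NeZero q] (x y : ℝ) :
    charHalfLineBiasSum q x y = ∑ n ∈ Finset.Icc 1 ⌊y⌋₊,
      (if (n : ZMod q) = 1 then (q.totient : ℂ) else 0) *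
        ((Λ n : ℂ) / (Real.sqrt n : ℂ) * (Real.log (x / n) : ℂ)) := by
  unfold charHalfLineBiasSum
  rw [Finset.sum_comm]
  refine Finset.sum_congr rfl fun n _ => ?_
  rw [← DirichletCharacter.sum_characters_eq ℂ (n : ZMod q), Finset.sum_mul]
  refine Finset.sum_congr rfl fun χ _ => ?_
  ring

/-- For `n ≥ 1`: `n ≡ 1 (mod q) ⟺ q ∣ n − 1`. [folklore] -/
private theorem natCast_eq_one_iff (q n : ℕ) (hn : 1 ≤ n) : ((n : ZMod q) = 1 ↔ q ∣ n - 1) := by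
  obtain ⟨k, rfl⟩ : ∃ k, n = k + 1 := ⟨n - 1, by omega⟩
  simp only [Nat.add_sub_cancel, Nat.cast_add, Nat.cast_one, add_eq_right]
  exact ZMod.natCast_eq_zero_iff k q

/-- `Σ_{d ∣ m} φ(d) = m` with the divisors `1` and `2` removed: for `2 ≤ n ≤ Q + 1`,
`Σ_{3 ≤ q ≤ Q, q ∣ n−1} φ(q) + 2 + [2 ∣ n−1] = n`. [cite: Suzuki2025Chebyshev, §5.2 («using Σ_{d|m} φ(d) = m»)] -/
theorem sum_Icc_totient_dvd (n Q : ℕ) (hn : 2 ≤ n) (hnQ : n ≤ Q + 1) :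
    ∑ q ∈ Finset.Icc 3 Q, (if q ∣ n - 1 then q.totient else 0) + 2
      + (if 2 ∣ n - 1 then 1 else 0) = n := by
  set N : ℕ := n - 1 with hN
  have hN0 : N ≠ 0 := by omega
  have htot := Nat.sum_totient N
  rw [← Finset.sum_filter_add_sum_filter_not N.divisors (fun d => 3 ≤ d)] at htot
  have hA : ∑ q ∈ Finset.Icc 3 Q, (if q ∣ N then q.totient else 0)
      = ∑ d ∈ N.divisors.filter (fun d => 3 ≤ d), d.totient := by
    rw [← Finset.sum_filter]
    congr 1
    ext d
    simp only [Finset.mem_filter, Finset.mem_Icc, Nat.mem_divisors]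
    constructor
    · rintro ⟨⟨h3, -⟩, hd⟩
      exact ⟨⟨hd, hN0⟩, h3⟩
    · rintro ⟨⟨hd, -⟩, h3⟩
      exact ⟨⟨h3, (Nat.le_of_dvd (by omega) hd).trans (by omega)⟩, hd⟩
  have hB : ∑ d ∈ N.divisors.filter (fun d => ¬ 3 ≤ d), d.totient
      = 1 + (if 2 ∣ N then 1 else 0) := by
    have hset : N.divisors.filter (fun d => ¬ 3 ≤ d)
        = (Finset.range 3).filter (fun d => d ∣ N) := by
      ext d
      simp only [Finset.mem_filter, Nat.mem_divisors, Finset.mem_range, not_le]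
      constructor
      · rintro ⟨⟨hd, -⟩, h3⟩
        exact ⟨h3, hd⟩
      · rintro ⟨h3, hd⟩
        exact ⟨⟨hd, hN0⟩, h3⟩
    rw [hset, Finset.sum_filter]
    simp only [Finset.sum_range_succ, Finset.sum_range_zero, Nat.totient_zero, Nat.totient_one,
      Nat.totient_two, one_dvd, if_true, zero_add]
    have h0 : ¬ (0 ∣ N) := by
      rintro ⟨k, hk⟩; omega
    simp [h0]
  omega


/-- **Summing the moduli `3 ≤ q ≤ Q` (orthogonality and `Σ_{d ∣ m} φ(d) = m`).** For `0 < x`,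
`1 ≤ y`, `⌊y⌋ ≤ Q`:
`Σ_{3 ≤ q ≤ Q} Σ_{χ mod q} Σ_{n ≤ y} Λ(n)χ(n) n^{-1/2} log(x/n) = Σ_{n ≤ y} Λ(n) n^{-1/2} log(x/n) (n − 2 − [2 ∣ n − 1])`
(all divisors of `n − 1` lie in `[1, Q]`; the divisors `1, 2` are excluded; `Λ(1) = 0`).
[cite: Suzuki2025Chebyshev, §5.2 eq. (5.10) and the display following it] -/
theorem sum_range_charHalfLineBiasSum_eq {x y : ℝ} (hx : 0 < x) {Q : ℕ} (hyQ : ⌊y⌋₊ ≤ Q) :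
    ∑ m ∈ Finset.range (Q - 2), charHalfLineBiasSum (m + 3) x y
      = ((∑ n ∈ Finset.Icc 1 ⌊y⌋₊, Λ n / √(n : ℝ) * (Real.log x - Real.log n)
          * ((n : ℝ) - 2 - ((if 2 ∣ n - 1 then 1 else 0 : ℕ) : ℝ)) : ℝ) : ℂ) := by
  simp_rw [charHalfLineBiasSum_eq]
  rw [Finset.sum_comm]
  push_cast
  refine Finset.sum_congr rfl fun n hn => ?_
  rw [← Finset.sum_mul]
  obtain ⟨hn1, hny⟩ := Finset.mem_Icc.mp hn
  have hn0 : (n : ℝ) ≠ 0 := by exact_mod_cast (show n ≠ 0 by omega)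
  have hlog : Real.log (x / n) = Real.log x - Real.log n := Real.log_div hx.ne' hn0
  rcases eq_or_lt_of_le hn1 with h1 | h2
  · subst h1
    simp [ArithmeticFunction.vonMangoldt_apply_one]
  · have hcoef : ∑ m ∈ Finset.range (Q - 2),
        (if (n : ZMod (m + 3)) = 1 then (((m + 3).totient : ℕ) : ℂ) else 0)
        = (n : ℂ) - 2 - ((if 2 ∣ n - 1 then 1 else 0 : ℕ) : ℂ) := by
      have hstep : ∀ m ∈ Finset.range (Q - 2),
          (if (n : ZMod (m + 3)) = 1 then (((m + 3).totient : ℕ) : ℂ) else 0)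
            = (if (m + 3) ∣ n - 1 then (((m + 3).totient : ℕ) : ℂ) else 0) := by
        intro m _
        by_cases h : (m + 3) ∣ n - 1
        · rw [if_pos h, if_pos ((natCast_eq_one_iff (m + 3) n hn1).2 h)]
        · rw [if_neg h, if_neg (fun h' => h ((natCast_eq_one_iff (m + 3) n hn1).1 h'))]
      rw [Finset.sum_congr rfl hstep,
        sum_range_sub_two (fun q => if q ∣ n - 1 then ((q.totient : ℕ) : ℂ) else 0) Q]
      have key := sum_Icc_totient_dvd n Q h2 (by omega)
      have h := congrArg (Nat.cast : ℕ → ℂ) key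
      push_cast at h ⊢
      linear_combination h
    rw [hcoef, hlog]
    split_ifs <;> push_cast <;> ring

/-- Splitting off the main term: `Λ(n) n^{-1/2} ℓ (n − 2 − i) = Λ(n)√n ℓ − Λ(n) n^{-1/2} ℓ (2 + i)`. [folklore] -/
private theorem sum_coef_split (x y : ℝ) :
    ∑ n ∈ Finset.Icc 1 ⌊y⌋₊, Λ n / √(n : ℝ) * (Real.log x - Real.log n)
        * ((n : ℝ) - 2 - ((if 2 ∣ n - 1 then 1 else 0 : ℕ) : ℝ))
      = ∑ n ∈ Finset.Icc 1 ⌊y⌋₊, Λ n * √(n : ℝ) * (Real.log x - Real.log n)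
        - ∑ n ∈ Finset.Icc 1 ⌊y⌋₊, Λ n / √(n : ℝ) * (Real.log x - Real.log n)
            * (2 + ((if 2 ∣ n - 1 then 1 else 0 : ℕ) : ℝ)) := by
  rw [← Finset.sum_sub_distrib]
  refine Finset.sum_congr rfl fun n hn => ?_
  obtain ⟨hn1, -⟩ := Finset.mem_Icc.mp hn
  have hn0 : (0 : ℝ) ≤ n := Nat.cast_nonneg n
  have hns : (n : ℝ) / √(n : ℝ) = √(n : ℝ) := Real.div_sqrt
  have h : Λ n / √(n : ℝ) * (Real.log x - Real.log n) * (n : ℝ)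
      = Λ n * √(n : ℝ) * (Real.log x - Real.log n) := by
    calc Λ n / √(n : ℝ) * (Real.log x - Real.log n) * (n : ℝ)
        = Λ n * ((n : ℝ) / √(n : ℝ)) * (Real.log x - Real.log n) := by ring
      _ = Λ n * √(n : ℝ) * (Real.log x - Real.log n) := by rw [hns]
  linear_combination h

/-- **The secondary terms are small**: for `0 < x`, `1 ≤ y`,
`|Σ_{n ≤ y} Λ(n) n^{-1/2} (log x − log n)(2 + [2 ∣ n−1])| ≤ 3 y log y (|log x| + log y)`
(`Λ(n) ≤ log n ≤ log y`, `⌊y⌋` terms). [folklore] -/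
private theorem abs_sum_secondary_le {x y : ℝ} (hy : 1 ≤ y) :
    |∑ n ∈ Finset.Icc 1 ⌊y⌋₊, Λ n / √(n : ℝ) * (Real.log x - Real.log n)
        * (2 + ((if 2 ∣ n - 1 then 1 else 0 : ℕ) : ℝ))|
      ≤ 3 * (y * (Real.log y * (|Real.log x| + Real.log y))) := by
  have hy0 : 0 ≤ y := by linarith
  have hfl : (⌊y⌋₊ : ℝ) ≤ y := Nat.floor_le hy0
  have hlogy : 0 ≤ Real.log y := Real.log_nonneg hy
  have hterm : ∀ n ∈ Finset.Icc 1 ⌊y⌋₊,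
      |Λ n / √(n : ℝ) * (Real.log x - Real.log n) * (2 + ((if 2 ∣ n - 1 then 1 else 0 : ℕ) : ℝ))|
        ≤ 3 * (Real.log y * (|Real.log x| + Real.log y)) := by
    intro n hn
    obtain ⟨hn1, hnN⟩ := Finset.mem_Icc.mp hn
    have hn1' : (1 : ℝ) ≤ n := by exact_mod_cast hn1
    have hn0 : (0 : ℝ) < n := by linarith
    have hny : (n : ℝ) ≤ y := le_trans (by exact_mod_cast hnN) hfl
    have hlogn0 : 0 ≤ Real.log n := Real.log_nonneg hn1'
    have hlogny : Real.log (n : ℝ) ≤ Real.log y := Real.log_le_log hn0 hny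
    have hΛ0 : 0 ≤ Λ n := ArithmeticFunction.vonMangoldt_nonneg
    have hΛ : Λ n ≤ Real.log n := ArithmeticFunction.vonMangoldt_le_log
    have hsq1 : 1 ≤ √(n : ℝ) := by
      have := Real.sqrt_le_sqrt hn1'
      rwa [Real.sqrt_one] at this
    have hA : Λ n / √(n : ℝ) ≤ Real.log y :=
      (div_le_self hΛ0 hsq1).trans (hΛ.trans hlogny)
    have hA0 : 0 ≤ Λ n / √(n : ℝ) := by positivity
    have hB : |Real.log x - Real.log n| ≤ |Real.log x| + Real.log y := by
      calc |Real.log x - Real.log n| ≤ |Real.log x| + |Real.log (n : ℝ)| := abs_sub _ _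
        _ ≤ |Real.log x| + Real.log y := by rw [abs_of_nonneg hlogn0]; linarith
    have hC : |(2 + ((if 2 ∣ n - 1 then 1 else 0 : ℕ) : ℝ))| ≤ 3 := by
      split_ifs <;> norm_num
    rw [abs_mul, abs_mul, abs_of_nonneg hA0]
    calc Λ n / √(n : ℝ) * |Real.log x - Real.log n| * |(2 + ((if 2 ∣ n - 1 then 1 else 0 : ℕ) : ℝ))|
        ≤ Real.log y * (|Real.log x| + Real.log y) * 3 := by
          gcongr
      _ = 3 * (Real.log y * (|Real.log x| + Real.log y)) := by ring
  calc |∑ n ∈ Finset.Icc 1 ⌊y⌋₊, Λ n / √(n : ℝ) * (Real.log x - Real.log n)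
          * (2 + ((if 2 ∣ n - 1 then 1 else 0 : ℕ) : ℝ))|
      ≤ ∑ n ∈ Finset.Icc 1 ⌊y⌋₊, |Λ n / √(n : ℝ) * (Real.log x - Real.log n)
          * (2 + ((if 2 ∣ n - 1 then 1 else 0 : ℕ) : ℝ))| := Finset.abs_sum_le_sum_abs _ _
    _ ≤ ∑ n ∈ Finset.Icc 1 ⌊y⌋₊, 3 * (Real.log y * (|Real.log x| + Real.log y)) :=
        Finset.sum_le_sum hterm
    _ = (⌊y⌋₊ : ℝ) * (3 * (Real.log y * (|Real.log x| + Real.log y))) := by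
        rw [Finset.sum_const, Nat.card_Icc, nsmul_eq_mul]
        norm_num
    _ ≤ y * (3 * (Real.log y * (|Real.log x| + Real.log y))) :=
        mul_le_mul_of_nonneg_right hfl (by positivity)
    _ = 3 * (y * (Real.log y * (|Real.log x| + Real.log y))) := by ring

/-- `x (log x + 2)² = o(x√x)`. [folklore] -/
private theorem isLittleO_mul_log_add_two_sq :
    (fun x : ℝ => x * (Real.log x + 2) ^ 2) =o[atTop] fun x : ℝ => x * √x := by
  have hlog : Real.log =o[atTop] fun x : ℝ => x ^ (1 / 4 : ℝ) :=
    isLittleO_log_rpow_atTop (by norm_num : (0 : ℝ) < 1 / 4)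
  have hlog2 : (fun x : ℝ => Real.log x + 2) =O[atTop] Real.log := by
    refine IsBigO.of_bound 2 ?_
    filter_upwards [eventually_ge_atTop (Real.exp 2)] with x hx
    have hx0 : 0 < x := (Real.exp_pos 2).trans_le hx
    have h2 : 2 ≤ Real.log x := by
      rw [← Real.log_exp 2]; exact Real.log_le_log (Real.exp_pos 2) hx
    rw [Real.norm_of_nonneg (by linarith), Real.norm_of_nonneg (by linarith)]
    linarith
  have h1 : (fun x : ℝ => (Real.log x + 2) ^ 2) =o[atTop] fun x : ℝ => (x ^ (1 / 4 : ℝ)) ^ 2 :=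
    (hlog2.trans_isLittleO hlog).pow (by norm_num)
  have h2 : (fun x : ℝ => (x ^ (1 / 4 : ℝ)) ^ 2) =ᶠ[atTop] fun x : ℝ => √x := by
    filter_upwards [eventually_ge_atTop (0 : ℝ)] with x hx
    rw [← Real.rpow_natCast, ← Real.rpow_mul hx, Real.sqrt_eq_rpow]
    norm_num
  exact (isBigO_refl (fun x : ℝ => x) atTop).mul_isLittleO (h1.congr' EventuallyEq.rfl h2)

/-- The secondary terms along `y = x`: `o(x√x)`. [folklore] -/
private theorem isLittleO_secondary_self :
    (fun x : ℝ => ∑ n ∈ Finset.Icc 1 ⌊x⌋₊, Λ n / √(n : ℝ) * (Real.log x - Real.log n)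
        * (2 + ((if 2 ∣ n - 1 then 1 else 0 : ℕ) : ℝ))) =o[atTop] fun x : ℝ => x * √x := by
  refine IsBigO.trans_isLittleO ?_ isLittleO_mul_log_add_two_sq
  refine IsBigO.of_bound 6 ?_
  filter_upwards [eventually_ge_atTop (1 : ℝ)] with x hx
  have hlog0 : 0 ≤ Real.log x := Real.log_nonneg hx
  have hx0 : 0 ≤ x := by linarith
  have h := abs_sum_secondary_le (x := x) hx
  rw [abs_of_nonneg hlog0] at h
  rw [Real.norm_eq_abs, Real.norm_of_nonneg (by positivity)]
  refine h.trans ?_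
  have h1 : Real.log x * (Real.log x + Real.log x) ≤ 2 * (Real.log x + 2) ^ 2 := by
    nlinarith
  have := mul_le_mul_of_nonneg_left h1 hx0
  nlinarith

/-- The secondary terms along `y = xe²`: `o(x√x)`. [folklore] -/
private theorem isLittleO_secondary_exp_two :
    (fun x : ℝ => ∑ n ∈ Finset.Icc 1 ⌊x * Real.exp 2⌋₊, Λ n / √(n : ℝ) * (Real.log x - Real.log n)
        * (2 + ((if 2 ∣ n - 1 then 1 else 0 : ℕ) : ℝ))) =o[atTop] fun x : ℝ => x * √x := by
  refine IsBigO.trans_isLittleO ?_ isLittleO_mul_log_add_two_sq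
  refine IsBigO.of_bound (6 * Real.exp 2) ?_
  filter_upwards [eventually_ge_atTop (1 : ℝ)] with x hx
  have hlog0 : 0 ≤ Real.log x := Real.log_nonneg hx
  have hx0 : 0 < x := by linarith
  have he1 : 1 ≤ Real.exp 2 := Real.one_le_exp (by norm_num)
  have hy : 1 ≤ x * Real.exp 2 := one_le_mul_of_one_le_of_one_le hx he1
  have h := abs_sum_secondary_le (x := x) hy
  have hlogy : Real.log (x * Real.exp 2) = Real.log x + 2 := by
    rw [Real.log_mul hx0.ne' (Real.exp_pos 2).ne', Real.log_exp]
  rw [abs_of_nonneg hlog0, hlogy] at h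
  rw [Real.norm_eq_abs, Real.norm_of_nonneg (by positivity)]
  refine h.trans ?_
  have h1 : (Real.log x + 2) * (Real.log x + (Real.log x + 2)) ≤ 2 * (Real.log x + 2) ^ 2 := by
    nlinarith
  have h2 : 0 ≤ x * Real.exp 2 := by positivity
  have := mul_le_mul_of_nonneg_left h1 h2
  nlinarith [Real.exp_pos 2]

end ChebyshevHalfLineBiasThm7

open ChebyshevHalfLineBiasThm7 in
/-- **Suzuki 2025, Theorem 7, PROVED** — discharge of the named fact `Suzuki2025Chebyshev_thm7`
(`ChebyshevHalfLineBiasVariants.lean`): the average over the moduli `3 ≤ q ≤ Q` of the character-summed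
half-line bias is `4√x[(1/9)x(1 + o(1)) − Q]` at the cut-off `x` (`Q ≥ x`, (1.26)) and
`−(8/9)e³ x√x (1 + o(1))` at the cut-off `xe²` (`Q ≥ xe²`, (1.27)), AS TYPED there. RH-FREE: orthogonality of
characters, `Σ_{d ∣ m} φ(d) = m`, partial summation and the prime number theorem `ψ(x) ∼ x`
(the tree's `chebyshevPsi_isEquivalent_holds`); no zeros of any `L`-function enter.
[cite: Suzuki2025Chebyshev, §1.3 Thm 7 with §5.2 (proof)] -/
theorem Suzuki2025Chebyshev_thm7_holds : Suzuki2025Chebyshev_thm7 := by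
  refine ⟨fun Q hQ => ?_, fun Q hQ => ?_⟩
  · -- (1.26): cut-off `x`, `Q(x) ≥ x`
    have hmain := sum_vonMangoldt_sqrt_weight_isLittleO 0
    simp only [add_zero, mul_zero, zero_add] at hmain
    have hsec := isLittleO_secondary_self
    have h8 : (fun x : ℝ => 8 * √x) =o[atTop] fun x : ℝ => x * √x :=
      (isLittleO_const_id_atTop (8 : ℝ)).mul_isBigO (isBigO_refl (fun x : ℝ => √x) atTop)
    have hreal := (hmain.sub hsec).add h8
    have hC := Complex.isLittleO_ofReal_left.mpr hreal
    refine hC.congr' ?_ EventuallyEq.rfl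
    filter_upwards [eventually_ge_atTop (2 : ℝ)] with x hx
    have hx0 : 0 < x := by linarith
    have hQ2 : 2 ≤ Q x := by exact_mod_cast (hx.trans (hQ x))
    have hfl : ⌊x⌋₊ ≤ Q x := (Nat.floor_le_floor (hQ x)).trans (Nat.floor_natCast _).le
    rw [Finset.sum_sub_distrib, Finset.sum_const, Finset.card_range, nsmul_eq_mul,
      sum_range_charHalfLineBiasSum_eq hx0 hfl, sum_coef_split, Nat.cast_sub hQ2]
    push_cast
    ring
  · -- (1.27): cut-off `xe²`, `Q(x) ≥ xe²`
    have hmain := (sum_vonMangoldt_sqrt_weight_isLittleO (-2)).comp_tendsto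
      (tendsto_id.atTop_mul_const (Real.exp_pos 2))
    have he : √(Real.exp 2) = Real.exp 1 := by
      have h2 : Real.exp 2 = Real.exp 1 ^ 2 := by
        rw [Real.exp_one_pow 2]; norm_num
      rw [h2]
      exact Real.sqrt_sq (Real.exp_pos 1).le
    have he3 : Real.exp 2 * Real.exp 1 = Real.exp 3 := by
      rw [← Real.exp_add]; norm_num
    have hg : (fun x : ℝ => (x * Real.exp 2) * √(x * Real.exp 2)) =ᶠ[atTop]
        fun x : ℝ => Real.exp 3 * (x * √x) := by
      filter_upwards [eventually_ge_atTop (0 : ℝ)] with x hx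
      rw [Real.sqrt_mul hx, he, ← he3]
      ring
    have hmain' : (fun x : ℝ => ∑ n ∈ Finset.Icc 1 ⌊x * Real.exp 2⌋₊,
        Λ n * √(n : ℝ) * (Real.log x - Real.log n) + 8 / 9 * Real.exp 3 * (x * √x))
          =o[atTop] fun x : ℝ => x * √x := by
      refine (hmain.congr' ?_ hg).trans_isBigO ((isBigO_refl _ _).const_mul_left (Real.exp 3))
      filter_upwards [eventually_gt_atTop (0 : ℝ)] with x hx
      simp only [Function.comp_apply, id]
      have hlog2 : Real.log (x * Real.exp 2) = Real.log x + 2 := by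
        rw [Real.log_mul hx.ne' (Real.exp_pos 2).ne', Real.log_exp]
      have hsimp : ∀ b : ℝ, Real.log x + 2 + -2 - b = Real.log x - b := fun b => by ring
      simp_rw [hlog2, hsimp]
      rw [Real.sqrt_mul hx.le, he, ← he3]
      ring
    have hsec := isLittleO_secondary_exp_two
    have hreal := hmain'.sub hsec
    have hC := Complex.isLittleO_ofReal_left.mpr hreal
    refine hC.congr' ?_ EventuallyEq.rfl
    filter_upwards [eventually_ge_atTop (1 : ℝ)] with x hx
    have hx0 : 0 < x := by linarith
    have hfl : ⌊x * Real.exp 2⌋₊ ≤ Q x :=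
      (Nat.floor_le_floor (hQ x)).trans (Nat.floor_natCast _).le
    rw [sum_range_charHalfLineBiasSum_eq hx0 hfl, sum_coef_split]
    push_cast
    ring

end Literature.NumberTheory.LFunctions

end
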